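import Summits.QuantumFields.YangMills.Theorems.UnitScaleTiltProp7OneFormRemainderDecay
import HarnessLib

/-!
# Route `UnitScaleTilt`, crux K1 «MinimiserStabilityRegPr» (stmt-QuantumFields-19200), EX face — ONE-FORM ∕ K137 STOREYS, FILE (K1-alg, part 1 of 2):
# **THE WEIGHTED COLUMN GAUGE OF DISPLAYED KERNEL ROWS** — bond operators carrying the pointwise row `‖(B δ_b Z)(b_d)‖ ≤ C_k·e^{−μ′·dc(B(b), B(b_d))}·‖Z‖` (O4e's `hk` text)
# form a cone containing `0` and `1`, and their exponentially weighted column sums are a SUBMULTIPLICATIVE gauge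

Cell `ym3-torus` (HUMAN RULING D-0037; rung R3 = SU(2) YM₃ on T³ — NOT d = 4, NOT infinite volume, NOT a mass gap, NOT Clay).  Width seat px10 g12 (FREE px;
★`ym-ust-19200-p1` g26 CHAIR WORD №14 names `…KernelRowComposition` «row algebra: comp∕id∕pow∕finite Neumann for the p.421 perturbation series around G₀» — this is its
part 1; part 2 `…Prop7KernelRowComposition` carries the composition row, powers and the Neumann inverse).  THEOREMS ONLY (0 `def`, 0 `sorry`, default heartbeats);
`--supports stmt-QuantumFields-19200 --as helper`; count-neutral.

THE TWO TEXTS (stated inline, never defined).  For `B : BondL2K →ₗ[ℂ] BondL2K` (the weighted bond `L²` space of the member `(F, n, K)`, weight `c₀`), `dc(b, b′) :=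
tdist(B_{K−n}(b.src), B_{K−n}(b′.src))` the block pseudo-distance on the coarse torus:
* ROW(B; C, μ′)  := `∀ b Z b_d, ‖toL2⁻¹(B(toL2 (δ_b Z)))(b_d)‖ ≤ C·e^{−μ′·dc(b, b_d)}·‖Z‖` — O4e ✓`norm_symm_apply_le_of_kernelRow_blockDecay`'s `hk`, the EX row `h349`'s member text;
* COLW(B; N, r) := `∀ b Z, Σ_{b_d} ‖toL2⁻¹(B(toL2 (δ_b Z)))(b_d)‖·e^{+r·dc(b, b_d)} ≤ N·‖Z‖` — the exponentially weighted column sum.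
THE ARGUMENT.  ROW(C, μ′) ⇒ COLW(C·V·S_{μ′−r}, r) for `r < μ′` (group the bonds by coarse block: `V := d·(L^d)^{K−n}` bonds per block ✓`card_filter_src_block_eq`, coarse volume
`S_ν := (2(1+1∕ν))³` ✓`sum_exp_neg_mul_tdist_coarse_le`); COLW ⇒ ROW with the same letters (one term of a non-negative sum); COLW is closed under composition with the PRODUCT
of the constants (expand the middle vector in bond spikes, weight triangle through `B(b′)` ✓`tdist_coarse_triangle`, `Finset.sum_comm`).  AT THE PINS `C = c·ℓ⁻³`, `V = 3ℓ³` (d = 3): `C·V·S = 3c·S` is K-FREE (CHAIR WORD №14's normalisation warning, honoured).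
WHAT IS PROVED (ns `Summit.QuantumFields.YangMills.Theorems.Prop7KernelRowColumnGauge`).
* §0 `symm_apply_eq_sum_single` (bond-spike expansion), `sum_pbond_blockwise` (`Σ_b f(B(b)) = V·Σ_y f(y)`), `exp_tdist_coarse_triangle`, `tdist_coarse_self`.
* §1 ROW is a cone: `kernelRow_mono`, `kernelRow_one`, `kernelRow_zero`, `kernelRow_add`, `kernelRow_sub`, `kernelRow_smul`, `kernelRow_sum`.
* §2 COLW: ★`colw_of_kernelRow`, `kernelRow_of_colw`, ★`colw_apply_le` (the weighted `ℓ¹` bound on a general vector), ★`colw_mul`, `colw_one`, `colw_zero`, `colw_add`, `colw_smul`,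
  `colw_mono`, `colw_sum` (powers, Neumann sums and the inverse: part 2).
HONEST SCOPE.  Row algebra ∕ bookkeeping over displayed letters; no estimate of print is proved; nothing of `hk_G₀` (K2), the γ-row, the K137 storey, the ten EX rows, EX or the
crux is proved here; the Yang–Mills mass gap is NOT proved.

References: T. Bałaban, CMP **99** (1985) 389–434 [Balaban1985BackgroundPropagators] ((3.46)–(3.49) pp.398–399, (3.86), (3.131)–(3.134)); CMP **96** (1984) 223–250 [Balaban1984PropagatorsII] (§2).
-/

set_option autoImplicit false

noncomputable section

open scoped BigOperators Matrix.Norms.L2Operator InnerProductSpace ComplexConjugate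

namespace Summit.QuantumFields.YangMills.Theorems.Prop7KernelRowColumnGauge

open Literature.MathematicalPhysics.QuantumFieldTheory.Balaban1983to89
open Literature.MathematicalPhysics.QuantumFieldTheory.Balaban1983to89.T3ContinuumYM3Torus
open B11Eq103H1Complex (BondL2K)
open B5Eq118OneStroke (iterBlockOf)
open Summit.QuantumFields.YangMills.Theorems.Prop7SectET3Transport (periodsT3)
open Summit.QuantumFields.YangMills.Theorems.Prop7SectET3HilbertLetters (W₂ toL2)
open Summit.QuantumFields.YangMills.Theorems.Prop7BlockDistanceWeights (sum_exp_neg_mul_tdist_coarse_le tdist_coarse_comm tdist_coarse_triangle)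
open Summit.QuantumFields.YangMills.Theorems.Prop7OneFormRemainderDecay (card_filter_src_block_eq)

variable (F : T3Family) {n K : ℕ} {c₀ : ℝ}

/-! ## §0 Bookkeeping: bond-spike expansion, blockwise sums, the weight triangle -/

/-- `toL2⁻¹(B(toL2 X))(b_d) = Σ_b toL2⁻¹(B(toL2 (δ_b X(b))))(b_d)` — linearity over the bond-spike expansion `X = Σ_b δ_b X(b)`. [folklore] -/
theorem symm_apply_eq_sum_single (B : BondL2K ℂ 3 (periodsT3 F K) c₀ W₂ →ₗ[ℂ] BondL2K ℂ 3 (periodsT3 F K) c₀ W₂)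
    (X : PBond (F.P K) 0 → Matrix (Fin 2) (Fin 2) ℂ) (bd : PBond (F.P K) 0) :
    (toL2 F K c₀).symm (B (toL2 F K c₀ X)) bd
      = ∑ b : PBond (F.P K) 0, (toL2 F K c₀).symm (B (toL2 F K c₀ (Pi.single b (X b)))) bd := by
  conv_lhs => rw [← Finset.univ_sum_single X]
  rw [map_sum, map_sum, map_sum, Finset.sum_apply]

/-- `Σ_{b} f(B_{K−n}(b.src)) = d·(L^d)^{K−n}·Σ_y f(y)` — every coarse block carries `d·(L^d)^{K−n}` bonds. [cite: Balaban1985Averaging, (2) p.17] -/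
theorem sum_pbond_blockwise (f : Site (F.P K) (K - n) → ℝ) :
    ∑ b : PBond (F.P K) 0, f (iterBlockOf (K - n) b.src)
      = ((F.P K).d : ℝ) * ((((F.P K).L : ℝ) ^ (F.P K).d) ^ (K - n)) * ∑ y : Site (F.P K) (K - n), f y := by
  classical
  rw [← Finset.sum_fiberwise_of_maps_to (s := Finset.univ) (t := Finset.univ) (g := fun b : PBond (F.P K) 0 => iterBlockOf (K - n) b.src)
    (fun b _ => Finset.mem_univ _), Finset.mul_sum]
  refine Finset.sum_congr rfl fun y _ => ?_
  rw [Finset.sum_congr rfl fun b hb => by rw [(Finset.mem_filter.mp hb).2], Finset.sum_const, nsmul_eq_mul, card_filter_src_block_eq F y]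

/-- The weight triangle: `e^{r·dc(z, w)} ≤ e^{r·dc(z, y)}·e^{r·dc(y, w)}` for `0 ≤ r`. [folklore] -/
theorem exp_tdist_coarse_triangle {r : ℝ} (hr : 0 ≤ r) (z y w : Site (F.P K) (K - n)) :
    Real.exp (r * (Site.tdist z w : ℝ)) ≤ Real.exp (r * (Site.tdist z y : ℝ)) * Real.exp (r * (Site.tdist y w : ℝ)) := by
  rw [← Real.exp_add, Real.exp_le_exp]
  nlinarith [mul_le_mul_of_nonneg_left (tdist_coarse_triangle F z y w) hr]

/-- The coarse self-distance vanishes (real-cast). [folklore] -/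
theorem tdist_coarse_self (y : Site (F.P K) (K - n)) : (Site.tdist y y : ℝ) = 0 := by
  have : Site.tdist y y = 0 := by simp [Site.tdist]
  exact_mod_cast this

/-! ## §1 ROW is a cone containing `0` and `1` -/

/-- ROW is monotone in its letters: `C ≤ C′`, `μ″ ≤ μ′` ⇒ ROW(B; C, μ′) ⇒ ROW(B; C′, μ″). [folklore] -/
theorem kernelRow_mono (B : BondL2K ℂ 3 (periodsT3 F K) c₀ W₂ →ₗ[ℂ] BondL2K ℂ 3 (periodsT3 F K) c₀ W₂) {Ck Ck' μ' μ'' : ℝ}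
    (hCk0 : 0 ≤ Ck) (hCk : Ck ≤ Ck') (hμ : μ'' ≤ μ')
    (hk : ∀ (b : PBond (F.P K) 0) (Z : Matrix (Fin 2) (Fin 2) ℂ) (bd : PBond (F.P K) 0),
      ‖(toL2 F K c₀).symm (B (toL2 F K c₀ (Pi.single b Z))) bd‖
        ≤ Ck * Real.exp (-(μ' * (Site.tdist (P := F.P K) (iterBlockOf (K - n) b.src) (iterBlockOf (K - n) bd.src) : ℝ))) * ‖Z‖)
    (b : PBond (F.P K) 0) (Z : Matrix (Fin 2) (Fin 2) ℂ) (bd : PBond (F.P K) 0) :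
    ‖(toL2 F K c₀).symm (B (toL2 F K c₀ (Pi.single b Z))) bd‖
      ≤ Ck' * Real.exp (-(μ'' * (Site.tdist (P := F.P K) (iterBlockOf (K - n) b.src) (iterBlockOf (K - n) bd.src) : ℝ))) * ‖Z‖ := by
  refine (hk b Z bd).trans ?_
  have hd : (0:ℝ) ≤ (Site.tdist (P := F.P K) (iterBlockOf (K - n) b.src) (iterBlockOf (K - n) bd.src) : ℝ) := Nat.cast_nonneg _
  have he : Real.exp (-(μ' * (Site.tdist (P := F.P K) (iterBlockOf (K - n) b.src) (iterBlockOf (K - n) bd.src) : ℝ)))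
      ≤ Real.exp (-(μ'' * (Site.tdist (P := F.P K) (iterBlockOf (K - n) b.src) (iterBlockOf (K - n) bd.src) : ℝ))) :=
    Real.exp_le_exp.2 (by nlinarith)
  have hCk' : 0 ≤ Ck' := hCk0.trans hCk
  calc Ck * Real.exp (-(μ' * (Site.tdist (P := F.P K) (iterBlockOf (K - n) b.src) (iterBlockOf (K - n) bd.src) : ℝ))) * ‖Z‖
      ≤ Ck' * Real.exp (-(μ' * (Site.tdist (P := F.P K) (iterBlockOf (K - n) b.src) (iterBlockOf (K - n) bd.src) : ℝ))) * ‖Z‖ :=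
        mul_le_mul_of_nonneg_right (mul_le_mul_of_nonneg_right hCk (Real.exp_pos _).le) (norm_nonneg _)
    _ ≤ Ck' * Real.exp (-(μ'' * (Site.tdist (P := F.P K) (iterBlockOf (K - n) b.src) (iterBlockOf (K - n) bd.src) : ℝ))) * ‖Z‖ :=
        mul_le_mul_of_nonneg_right (mul_le_mul_of_nonneg_left he hCk') (norm_nonneg _)

/-- ROW(1; 1, μ′) for every rate: the identity's kernel is the bond diagonal. [folklore] -/
theorem kernelRow_one (μ' : ℝ) (b : PBond (F.P K) 0) (Z : Matrix (Fin 2) (Fin 2) ℂ) (bd : PBond (F.P K) 0) :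
    ‖(toL2 F K c₀).symm ((1 : Module.End ℂ (BondL2K ℂ 3 (periodsT3 F K) c₀ W₂)) (toL2 F K c₀ (Pi.single b Z))) bd‖
      ≤ 1 * Real.exp (-(μ' * (Site.tdist (P := F.P K) (iterBlockOf (K - n) b.src) (iterBlockOf (K - n) bd.src) : ℝ))) * ‖Z‖ := by
  rw [Module.End.one_apply, LinearEquiv.symm_apply_apply]
  by_cases h : bd = b
  · subst h
    rw [Pi.single_eq_same, tdist_coarse_self, mul_zero, neg_zero, Real.exp_zero, one_mul, one_mul]
  · rw [Pi.single_eq_of_ne h, norm_zero]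
    positivity

/-- ROW(0; 0, μ′). [folklore] -/
theorem kernelRow_zero (μ' : ℝ) (b : PBond (F.P K) 0) (Z : Matrix (Fin 2) (Fin 2) ℂ) (bd : PBond (F.P K) 0) :
    ‖(toL2 F K c₀).symm ((0 : BondL2K ℂ 3 (periodsT3 F K) c₀ W₂ →ₗ[ℂ] BondL2K ℂ 3 (periodsT3 F K) c₀ W₂) (toL2 F K c₀ (Pi.single b Z))) bd‖
      ≤ 0 * Real.exp (-(μ' * (Site.tdist (P := F.P K) (iterBlockOf (K - n) b.src) (iterBlockOf (K - n) bd.src) : ℝ))) * ‖Z‖ := by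
  rw [LinearMap.zero_apply, map_zero, Pi.zero_apply, norm_zero, zero_mul, zero_mul]

/-- ROW is additive in the operator at a common rate: ROW(B₁; C₁, μ′), ROW(B₂; C₂, μ′) ⇒ ROW(B₁ + B₂; C₁ + C₂, μ′). [folklore] -/
theorem kernelRow_add (B₁ B₂ : BondL2K ℂ 3 (periodsT3 F K) c₀ W₂ →ₗ[ℂ] BondL2K ℂ 3 (periodsT3 F K) c₀ W₂) {C₁ C₂ μ' : ℝ}
    (h₁ : ∀ (b : PBond (F.P K) 0) (Z : Matrix (Fin 2) (Fin 2) ℂ) (bd : PBond (F.P K) 0),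
      ‖(toL2 F K c₀).symm (B₁ (toL2 F K c₀ (Pi.single b Z))) bd‖
        ≤ C₁ * Real.exp (-(μ' * (Site.tdist (P := F.P K) (iterBlockOf (K - n) b.src) (iterBlockOf (K - n) bd.src) : ℝ))) * ‖Z‖)
    (h₂ : ∀ (b : PBond (F.P K) 0) (Z : Matrix (Fin 2) (Fin 2) ℂ) (bd : PBond (F.P K) 0),
      ‖(toL2 F K c₀).symm (B₂ (toL2 F K c₀ (Pi.single b Z))) bd‖
        ≤ C₂ * Real.exp (-(μ' * (Site.tdist (P := F.P K) (iterBlockOf (K - n) b.src) (iterBlockOf (K - n) bd.src) : ℝ))) * ‖Z‖)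
    (b : PBond (F.P K) 0) (Z : Matrix (Fin 2) (Fin 2) ℂ) (bd : PBond (F.P K) 0) :
    ‖(toL2 F K c₀).symm ((B₁ + B₂) (toL2 F K c₀ (Pi.single b Z))) bd‖
      ≤ (C₁ + C₂) * Real.exp (-(μ' * (Site.tdist (P := F.P K) (iterBlockOf (K - n) b.src) (iterBlockOf (K - n) bd.src) : ℝ))) * ‖Z‖ := by
  rw [LinearMap.add_apply, map_add, Pi.add_apply]
  refine (norm_add_le _ _).trans ?_
  have := add_le_add (h₁ b Z bd) (h₂ b Z bd)
  linarith

/-- ROW under subtraction: ROW(B₁; C₁, μ′), ROW(B₂; C₂, μ′) ⇒ ROW(B₁ − B₂; C₁ + C₂, μ′). [folklore] -/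
theorem kernelRow_sub (B₁ B₂ : BondL2K ℂ 3 (periodsT3 F K) c₀ W₂ →ₗ[ℂ] BondL2K ℂ 3 (periodsT3 F K) c₀ W₂) {C₁ C₂ μ' : ℝ}
    (h₁ : ∀ (b : PBond (F.P K) 0) (Z : Matrix (Fin 2) (Fin 2) ℂ) (bd : PBond (F.P K) 0),
      ‖(toL2 F K c₀).symm (B₁ (toL2 F K c₀ (Pi.single b Z))) bd‖
        ≤ C₁ * Real.exp (-(μ' * (Site.tdist (P := F.P K) (iterBlockOf (K - n) b.src) (iterBlockOf (K - n) bd.src) : ℝ))) * ‖Z‖)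
    (h₂ : ∀ (b : PBond (F.P K) 0) (Z : Matrix (Fin 2) (Fin 2) ℂ) (bd : PBond (F.P K) 0),
      ‖(toL2 F K c₀).symm (B₂ (toL2 F K c₀ (Pi.single b Z))) bd‖
        ≤ C₂ * Real.exp (-(μ' * (Site.tdist (P := F.P K) (iterBlockOf (K - n) b.src) (iterBlockOf (K - n) bd.src) : ℝ))) * ‖Z‖)
    (b : PBond (F.P K) 0) (Z : Matrix (Fin 2) (Fin 2) ℂ) (bd : PBond (F.P K) 0) :
    ‖(toL2 F K c₀).symm ((B₁ - B₂) (toL2 F K c₀ (Pi.single b Z))) bd‖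
      ≤ (C₁ + C₂) * Real.exp (-(μ' * (Site.tdist (P := F.P K) (iterBlockOf (K - n) b.src) (iterBlockOf (K - n) bd.src) : ℝ))) * ‖Z‖ := by
  rw [LinearMap.sub_apply, map_sub, Pi.sub_apply]
  refine (norm_sub_le _ _).trans ?_
  have := add_le_add (h₁ b Z bd) (h₂ b Z bd)
  linarith

/-- ROW under scalars: ROW(B; C, μ′) ⇒ ROW(c • B; ‖c‖·C, μ′). [folklore] -/
theorem kernelRow_smul (B : BondL2K ℂ 3 (periodsT3 F K) c₀ W₂ →ₗ[ℂ] BondL2K ℂ 3 (periodsT3 F K) c₀ W₂) (c : ℂ) {Ck μ' : ℝ}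
    (hk : ∀ (b : PBond (F.P K) 0) (Z : Matrix (Fin 2) (Fin 2) ℂ) (bd : PBond (F.P K) 0),
      ‖(toL2 F K c₀).symm (B (toL2 F K c₀ (Pi.single b Z))) bd‖
        ≤ Ck * Real.exp (-(μ' * (Site.tdist (P := F.P K) (iterBlockOf (K - n) b.src) (iterBlockOf (K - n) bd.src) : ℝ))) * ‖Z‖)
    (b : PBond (F.P K) 0) (Z : Matrix (Fin 2) (Fin 2) ℂ) (bd : PBond (F.P K) 0) :
    ‖(toL2 F K c₀).symm ((c • B) (toL2 F K c₀ (Pi.single b Z))) bd‖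
      ≤ (‖c‖ * Ck) * Real.exp (-(μ' * (Site.tdist (P := F.P K) (iterBlockOf (K - n) b.src) (iterBlockOf (K - n) bd.src) : ℝ))) * ‖Z‖ := by
  rw [LinearMap.smul_apply, map_smul, Pi.smul_apply, norm_smul]
  have := mul_le_mul_of_nonneg_left (hk b Z bd) (norm_nonneg c)
  refine this.trans_eq ?_
  ring

/-- ROW under finite sums: ROW(B i; C i, μ′) for `i ∈ s` ⇒ ROW(Σ_{i∈s} B i; Σ_{i∈s} C i, μ′). [folklore] -/
theorem kernelRow_sum {ι : Type*} (s : Finset ι) (B : ι → BondL2K ℂ 3 (periodsT3 F K) c₀ W₂ →ₗ[ℂ] BondL2K ℂ 3 (periodsT3 F K) c₀ W₂) (C : ι → ℝ) {μ' : ℝ}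
    (hk : ∀ i ∈ s, ∀ (b : PBond (F.P K) 0) (Z : Matrix (Fin 2) (Fin 2) ℂ) (bd : PBond (F.P K) 0),
      ‖(toL2 F K c₀).symm (B i (toL2 F K c₀ (Pi.single b Z))) bd‖
        ≤ C i * Real.exp (-(μ' * (Site.tdist (P := F.P K) (iterBlockOf (K - n) b.src) (iterBlockOf (K - n) bd.src) : ℝ))) * ‖Z‖)
    (b : PBond (F.P K) 0) (Z : Matrix (Fin 2) (Fin 2) ℂ) (bd : PBond (F.P K) 0) :
    ‖(toL2 F K c₀).symm ((∑ i ∈ s, B i) (toL2 F K c₀ (Pi.single b Z))) bd‖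
      ≤ (∑ i ∈ s, C i) * Real.exp (-(μ' * (Site.tdist (P := F.P K) (iterBlockOf (K - n) b.src) (iterBlockOf (K - n) bd.src) : ℝ))) * ‖Z‖ := by
  rw [LinearMap.sum_apply, map_sum, Finset.sum_apply, Finset.sum_mul, Finset.sum_mul]
  exact (norm_sum_le _ _).trans (Finset.sum_le_sum fun i hi => hk i hi b Z bd)

/-! ## §2 The weighted column sum COLW — the submultiplicative gauge -/

/-- ★ **ROW ⇒ COLW**: ROW(B; C, μ′), `0 ≤ r < μ′` ⇒ COLW(B; C·V·S_{μ′−r}, r) with `V = d·(L^d)^{K−n}` (bonds per coarse block) and `S_ν = (2(1+1∕ν))³` (coarse volume).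
[cite: Balaban1985BackgroundPropagators, (3.49) p.399] -/
theorem colw_of_kernelRow (B : BondL2K ℂ 3 (periodsT3 F K) c₀ W₂ →ₗ[ℂ] BondL2K ℂ 3 (periodsT3 F K) c₀ W₂) {Ck μ' r : ℝ}
    (hCk : 0 ≤ Ck) (hrμ : r < μ')
    (hk : ∀ (b : PBond (F.P K) 0) (Z : Matrix (Fin 2) (Fin 2) ℂ) (bd : PBond (F.P K) 0),
      ‖(toL2 F K c₀).symm (B (toL2 F K c₀ (Pi.single b Z))) bd‖
        ≤ Ck * Real.exp (-(μ' * (Site.tdist (P := F.P K) (iterBlockOf (K - n) b.src) (iterBlockOf (K - n) bd.src) : ℝ))) * ‖Z‖)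
    (b : PBond (F.P K) 0) (Z : Matrix (Fin 2) (Fin 2) ℂ) :
    ∑ bd : PBond (F.P K) 0, ‖(toL2 F K c₀).symm (B (toL2 F K c₀ (Pi.single b Z))) bd‖
        * Real.exp (r * (Site.tdist (P := F.P K) (iterBlockOf (K - n) b.src) (iterBlockOf (K - n) bd.src) : ℝ))
      ≤ Ck * (((F.P K).d : ℝ) * ((((F.P K).L : ℝ) ^ (F.P K).d) ^ (K - n))) * (2 * (1 + 1 / (μ' - r))) ^ 3 * ‖Z‖ := by
  classical
  set Bb := iterBlockOf (K - n) b.src with hBb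
  -- termwise: `‖T‖·e^{r d} ≤ C‖Z‖·e^{−(μ′−r) d}`
  have h1 : ∀ bd : PBond (F.P K) 0, ‖(toL2 F K c₀).symm (B (toL2 F K c₀ (Pi.single b Z))) bd‖
        * Real.exp (r * (Site.tdist (P := F.P K) Bb (iterBlockOf (K - n) bd.src) : ℝ))
      ≤ Ck * ‖Z‖ * Real.exp (-((μ' - r) * (Site.tdist (P := F.P K) Bb (iterBlockOf (K - n) bd.src) : ℝ))) := by
    intro bd
    calc ‖(toL2 F K c₀).symm (B (toL2 F K c₀ (Pi.single b Z))) bd‖ * Real.exp (r * (Site.tdist (P := F.P K) Bb (iterBlockOf (K - n) bd.src) : ℝ))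
        ≤ (Ck * Real.exp (-(μ' * (Site.tdist (P := F.P K) Bb (iterBlockOf (K - n) bd.src) : ℝ))) * ‖Z‖)
            * Real.exp (r * (Site.tdist (P := F.P K) Bb (iterBlockOf (K - n) bd.src) : ℝ)) :=
          mul_le_mul_of_nonneg_right (hk b Z bd) (Real.exp_pos _).le
      _ = Ck * ‖Z‖ * (Real.exp (-(μ' * (Site.tdist (P := F.P K) Bb (iterBlockOf (K - n) bd.src) : ℝ)))
            * Real.exp (r * (Site.tdist (P := F.P K) Bb (iterBlockOf (K - n) bd.src) : ℝ))) := by ring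
      _ = Ck * ‖Z‖ * Real.exp (-((μ' - r) * (Site.tdist (P := F.P K) Bb (iterBlockOf (K - n) bd.src) : ℝ))) := by
          rw [← Real.exp_add]; congr 1; ring
  -- blockwise: `Σ_{bd} e^{−ν d(Bb, B(bd))} = V·Σ_y e^{−ν d(y, Bb)} ≤ V·S_ν`
  have hν : 0 < μ' - r := by linarith
  have h2 : ∑ bd : PBond (F.P K) 0, Real.exp (-((μ' - r) * (Site.tdist (P := F.P K) Bb (iterBlockOf (K - n) bd.src) : ℝ)))
      ≤ (((F.P K).d : ℝ) * ((((F.P K).L : ℝ) ^ (F.P K).d) ^ (K - n))) * (2 * (1 + 1 / (μ' - r))) ^ 3 := by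
    rw [sum_pbond_blockwise F (fun y => Real.exp (-((μ' - r) * (Site.tdist (P := F.P K) Bb y : ℝ))))]
    refine mul_le_mul_of_nonneg_left ?_ (by positivity)
    calc ∑ y : Site (F.P K) (K - n), Real.exp (-((μ' - r) * (Site.tdist (P := F.P K) Bb y : ℝ)))
        = ∑ y : Site (F.P K) (K - n), Real.exp (-((μ' - r) * (Site.tdist (P := F.P K) y Bb : ℝ))) :=
          Finset.sum_congr rfl fun y _ => by rw [tdist_coarse_comm F Bb y]
      _ ≤ (2 * (1 + 1 / (μ' - r))) ^ 3 := sum_exp_neg_mul_tdist_coarse_le F (n := n) (K := K) hν Bb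
  calc ∑ bd : PBond (F.P K) 0, ‖(toL2 F K c₀).symm (B (toL2 F K c₀ (Pi.single b Z))) bd‖
          * Real.exp (r * (Site.tdist (P := F.P K) Bb (iterBlockOf (K - n) bd.src) : ℝ))
      ≤ ∑ bd : PBond (F.P K) 0, Ck * ‖Z‖ * Real.exp (-((μ' - r) * (Site.tdist (P := F.P K) Bb (iterBlockOf (K - n) bd.src) : ℝ))) :=
        Finset.sum_le_sum fun bd _ => h1 bd
    _ = Ck * ‖Z‖ * ∑ bd : PBond (F.P K) 0, Real.exp (-((μ' - r) * (Site.tdist (P := F.P K) Bb (iterBlockOf (K - n) bd.src) : ℝ))) := by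
        rw [Finset.mul_sum]
    _ ≤ Ck * ‖Z‖ * ((((F.P K).d : ℝ) * ((((F.P K).L : ℝ) ^ (F.P K).d) ^ (K - n))) * (2 * (1 + 1 / (μ' - r))) ^ 3) :=
        mul_le_mul_of_nonneg_left h2 (by positivity)
    _ = _ := by ring

/-- **COLW ⇒ ROW** with the same letters: one term of a non-negative sum. [folklore] -/
theorem kernelRow_of_colw (B : BondL2K ℂ 3 (periodsT3 F K) c₀ W₂ →ₗ[ℂ] BondL2K ℂ 3 (periodsT3 F K) c₀ W₂) {N r : ℝ}
    (hcol : ∀ (b : PBond (F.P K) 0) (Z : Matrix (Fin 2) (Fin 2) ℂ),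
      ∑ bd : PBond (F.P K) 0, ‖(toL2 F K c₀).symm (B (toL2 F K c₀ (Pi.single b Z))) bd‖
          * Real.exp (r * (Site.tdist (P := F.P K) (iterBlockOf (K - n) b.src) (iterBlockOf (K - n) bd.src) : ℝ)) ≤ N * ‖Z‖)
    (b : PBond (F.P K) 0) (Z : Matrix (Fin 2) (Fin 2) ℂ) (bd : PBond (F.P K) 0) :
    ‖(toL2 F K c₀).symm (B (toL2 F K c₀ (Pi.single b Z))) bd‖
      ≤ N * Real.exp (-(r * (Site.tdist (P := F.P K) (iterBlockOf (K - n) b.src) (iterBlockOf (K - n) bd.src) : ℝ))) * ‖Z‖ := by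
  classical
  have hE := Real.exp_pos (r * (Site.tdist (P := F.P K) (iterBlockOf (K - n) b.src) (iterBlockOf (K - n) bd.src) : ℝ))
  have hle : ‖(toL2 F K c₀).symm (B (toL2 F K c₀ (Pi.single b Z))) bd‖
        * Real.exp (r * (Site.tdist (P := F.P K) (iterBlockOf (K - n) b.src) (iterBlockOf (K - n) bd.src) : ℝ)) ≤ N * ‖Z‖ :=
    (Finset.single_le_sum (f := fun bd' : PBond (F.P K) 0 => ‖(toL2 F K c₀).symm (B (toL2 F K c₀ (Pi.single b Z))) bd'‖
        * Real.exp (r * (Site.tdist (P := F.P K) (iterBlockOf (K - n) b.src) (iterBlockOf (K - n) bd'.src) : ℝ)))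
      (fun bd' _ => by positivity) (Finset.mem_univ bd)).trans (hcol b Z)
  rw [Real.exp_neg]; rw [← le_div_iff₀ hE] at hle
  calc ‖(toL2 F K c₀).symm (B (toL2 F K c₀ (Pi.single b Z))) bd‖ ≤ N * ‖Z‖ / Real.exp (r * (Site.tdist (P := F.P K) (iterBlockOf (K - n) b.src) (iterBlockOf (K - n) bd.src) : ℝ)) := hle
    _ = _ := by field_simp

/-- ★ **THE WEIGHTED `ℓ¹` BOUND ON A GENERAL VECTOR**: COLW(B; N, r), `0 ≤ r` ⇒ `Σ_{b_d} ‖toL2⁻¹(B(toL2 X))(b_d)‖·e^{r dc(b₀, b_d)} ≤ N·Σ_{b′} ‖X(b′)‖·e^{r dc(b₀, b′)}` for every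
bond function `X` and base bond `b₀` (expand `X` in spikes, weight triangle through `B(b′)`, swap the sums). [cite: Balaban1984PropagatorsII, §2] -/
theorem colw_apply_le (B : BondL2K ℂ 3 (periodsT3 F K) c₀ W₂ →ₗ[ℂ] BondL2K ℂ 3 (periodsT3 F K) c₀ W₂) {N r : ℝ} (hr : 0 ≤ r)
    (hcol : ∀ (b : PBond (F.P K) 0) (Z : Matrix (Fin 2) (Fin 2) ℂ),
      ∑ bd : PBond (F.P K) 0, ‖(toL2 F K c₀).symm (B (toL2 F K c₀ (Pi.single b Z))) bd‖
          * Real.exp (r * (Site.tdist (P := F.P K) (iterBlockOf (K - n) b.src) (iterBlockOf (K - n) bd.src) : ℝ)) ≤ N * ‖Z‖)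
    (X : PBond (F.P K) 0 → Matrix (Fin 2) (Fin 2) ℂ) (b₀ : PBond (F.P K) 0) :
    ∑ bd : PBond (F.P K) 0, ‖(toL2 F K c₀).symm (B (toL2 F K c₀ X)) bd‖
        * Real.exp (r * (Site.tdist (P := F.P K) (iterBlockOf (K - n) b₀.src) (iterBlockOf (K - n) bd.src) : ℝ))
      ≤ N * ∑ b' : PBond (F.P K) 0, ‖X b'‖ * Real.exp (r * (Site.tdist (P := F.P K) (iterBlockOf (K - n) b₀.src) (iterBlockOf (K - n) b'.src) : ℝ)) := by
  classical
  have hN : ∀ b' : PBond (F.P K) 0, ∑ bd : PBond (F.P K) 0, ‖(toL2 F K c₀).symm (B (toL2 F K c₀ (Pi.single b' (X b')))) bd‖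
        * Real.exp (r * (Site.tdist (P := F.P K) (iterBlockOf (K - n) b'.src) (iterBlockOf (K - n) bd.src) : ℝ)) ≤ N * ‖X b'‖ :=
    fun b' => hcol b' (X b')
  calc ∑ bd : PBond (F.P K) 0, ‖(toL2 F K c₀).symm (B (toL2 F K c₀ X)) bd‖
          * Real.exp (r * (Site.tdist (P := F.P K) (iterBlockOf (K - n) b₀.src) (iterBlockOf (K - n) bd.src) : ℝ))
      ≤ ∑ bd : PBond (F.P K) 0, ∑ b' : PBond (F.P K) 0, ‖(toL2 F K c₀).symm (B (toL2 F K c₀ (Pi.single b' (X b')))) bd‖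
          * (Real.exp (r * (Site.tdist (P := F.P K) (iterBlockOf (K - n) b₀.src) (iterBlockOf (K - n) b'.src) : ℝ))
            * Real.exp (r * (Site.tdist (P := F.P K) (iterBlockOf (K - n) b'.src) (iterBlockOf (K - n) bd.src) : ℝ))) := by
        refine Finset.sum_le_sum fun bd _ => ?_
        rw [symm_apply_eq_sum_single F B X bd]
        calc ‖∑ b' : PBond (F.P K) 0, (toL2 F K c₀).symm (B (toL2 F K c₀ (Pi.single b' (X b')))) bd‖
              * Real.exp (r * (Site.tdist (P := F.P K) (iterBlockOf (K - n) b₀.src) (iterBlockOf (K - n) bd.src) : ℝ))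
            ≤ (∑ b' : PBond (F.P K) 0, ‖(toL2 F K c₀).symm (B (toL2 F K c₀ (Pi.single b' (X b')))) bd‖)
              * Real.exp (r * (Site.tdist (P := F.P K) (iterBlockOf (K - n) b₀.src) (iterBlockOf (K - n) bd.src) : ℝ)) :=
              mul_le_mul_of_nonneg_right (norm_sum_le _ _) (Real.exp_pos _).le
          _ = ∑ b' : PBond (F.P K) 0, ‖(toL2 F K c₀).symm (B (toL2 F K c₀ (Pi.single b' (X b')))) bd‖
              * Real.exp (r * (Site.tdist (P := F.P K) (iterBlockOf (K - n) b₀.src) (iterBlockOf (K - n) bd.src) : ℝ)) := Finset.sum_mul _ _ _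
          _ ≤ _ := Finset.sum_le_sum fun b' _ => mul_le_mul_of_nonneg_left
              (exp_tdist_coarse_triangle F hr (iterBlockOf (K - n) b₀.src) (iterBlockOf (K - n) b'.src) (iterBlockOf (K - n) bd.src)) (norm_nonneg _)
    _ = ∑ b' : PBond (F.P K) 0, Real.exp (r * (Site.tdist (P := F.P K) (iterBlockOf (K - n) b₀.src) (iterBlockOf (K - n) b'.src) : ℝ))
          * ∑ bd : PBond (F.P K) 0, ‖(toL2 F K c₀).symm (B (toL2 F K c₀ (Pi.single b' (X b')))) bd‖
            * Real.exp (r * (Site.tdist (P := F.P K) (iterBlockOf (K - n) b'.src) (iterBlockOf (K - n) bd.src) : ℝ)) := by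
        rw [Finset.sum_comm]
        refine Finset.sum_congr rfl fun b' _ => ?_
        rw [Finset.mul_sum]
        exact Finset.sum_congr rfl fun bd _ => by ring
    _ ≤ ∑ b' : PBond (F.P K) 0, Real.exp (r * (Site.tdist (P := F.P K) (iterBlockOf (K - n) b₀.src) (iterBlockOf (K - n) b'.src) : ℝ)) * (N * ‖X b'‖) :=
        Finset.sum_le_sum fun b' _ => mul_le_mul_of_nonneg_left (hN b') (Real.exp_pos _).le
    _ = _ := by
        rw [Finset.mul_sum]
        exact Finset.sum_congr rfl fun b' _ => by ring

/-- ★ **COLW IS SUBMULTIPLICATIVE**: COLW(B₁; N₁, r), COLW(B₂; N₂, r), `0 ≤ r`, `0 ≤ N₁` ⇒ COLW(B₁·B₂; N₁·N₂, r) (`·` = composition in `Module.End`).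
[cite: Balaban1984PropagatorsII, §2] -/
theorem colw_mul (B₁ B₂ : BondL2K ℂ 3 (periodsT3 F K) c₀ W₂ →ₗ[ℂ] BondL2K ℂ 3 (periodsT3 F K) c₀ W₂) {N₁ N₂ r : ℝ} (hr : 0 ≤ r) (hN₁ : 0 ≤ N₁)
    (h₁ : ∀ (b : PBond (F.P K) 0) (Z : Matrix (Fin 2) (Fin 2) ℂ),
      ∑ bd : PBond (F.P K) 0, ‖(toL2 F K c₀).symm (B₁ (toL2 F K c₀ (Pi.single b Z))) bd‖
          * Real.exp (r * (Site.tdist (P := F.P K) (iterBlockOf (K - n) b.src) (iterBlockOf (K - n) bd.src) : ℝ)) ≤ N₁ * ‖Z‖)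
    (h₂ : ∀ (b : PBond (F.P K) 0) (Z : Matrix (Fin 2) (Fin 2) ℂ),
      ∑ bd : PBond (F.P K) 0, ‖(toL2 F K c₀).symm (B₂ (toL2 F K c₀ (Pi.single b Z))) bd‖
          * Real.exp (r * (Site.tdist (P := F.P K) (iterBlockOf (K - n) b.src) (iterBlockOf (K - n) bd.src) : ℝ)) ≤ N₂ * ‖Z‖)
    (b : PBond (F.P K) 0) (Z : Matrix (Fin 2) (Fin 2) ℂ) :
    ∑ bd : PBond (F.P K) 0, ‖(toL2 F K c₀).symm ((B₁ * B₂) (toL2 F K c₀ (Pi.single b Z))) bd‖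
        * Real.exp (r * (Site.tdist (P := F.P K) (iterBlockOf (K - n) b.src) (iterBlockOf (K - n) bd.src) : ℝ)) ≤ N₁ * N₂ * ‖Z‖ := by
  have hX : (B₁ * B₂) (toL2 F K c₀ (Pi.single b Z))
      = B₁ (toL2 F K c₀ ((toL2 F K c₀).symm (B₂ (toL2 F K c₀ (Pi.single b Z))))) := by
    rw [Module.End.mul_apply, LinearEquiv.apply_symm_apply]
  simp_rw [hX]
  refine (colw_apply_le F B₁ hr h₁ _ b).trans ?_
  calc N₁ * ∑ b' : PBond (F.P K) 0, ‖(toL2 F K c₀).symm (B₂ (toL2 F K c₀ (Pi.single b Z))) b'‖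
          * Real.exp (r * (Site.tdist (P := F.P K) (iterBlockOf (K - n) b.src) (iterBlockOf (K - n) b'.src) : ℝ))
      ≤ N₁ * (N₂ * ‖Z‖) := mul_le_mul_of_nonneg_left (h₂ b Z) hN₁
    _ = _ := by ring

/-- COLW(1; 1, r): the identity's weighted column sum is `‖Z‖`. [folklore] -/
theorem colw_one (r : ℝ) (b : PBond (F.P K) 0) (Z : Matrix (Fin 2) (Fin 2) ℂ) :
    ∑ bd : PBond (F.P K) 0, ‖(toL2 F K c₀).symm ((1 : Module.End ℂ (BondL2K ℂ 3 (periodsT3 F K) c₀ W₂)) (toL2 F K c₀ (Pi.single b Z))) bd‖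
        * Real.exp (r * (Site.tdist (P := F.P K) (iterBlockOf (K - n) b.src) (iterBlockOf (K - n) bd.src) : ℝ)) ≤ 1 * ‖Z‖ := by
  classical
  simp_rw [Module.End.one_apply, LinearEquiv.symm_apply_apply]
  rw [Finset.sum_eq_single b (fun bd _ hbd => by rw [Pi.single_eq_of_ne hbd, norm_zero, zero_mul]) (fun h => absurd (Finset.mem_univ b) h),
    Pi.single_eq_same, tdist_coarse_self, mul_zero, Real.exp_zero, mul_one, one_mul]

/-- COLW(0; 0, r). [folklore] -/
theorem colw_zero (r : ℝ) (b : PBond (F.P K) 0) (Z : Matrix (Fin 2) (Fin 2) ℂ) :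
    ∑ bd : PBond (F.P K) 0, ‖(toL2 F K c₀).symm ((0 : BondL2K ℂ 3 (periodsT3 F K) c₀ W₂ →ₗ[ℂ] BondL2K ℂ 3 (periodsT3 F K) c₀ W₂) (toL2 F K c₀ (Pi.single b Z))) bd‖
        * Real.exp (r * (Site.tdist (P := F.P K) (iterBlockOf (K - n) b.src) (iterBlockOf (K - n) bd.src) : ℝ)) ≤ 0 * ‖Z‖ := by
  simp_rw [LinearMap.zero_apply, map_zero, Pi.zero_apply, norm_zero, zero_mul, Finset.sum_const_zero, le_refl]

/-- COLW is additive: COLW(B₁; N₁, r), COLW(B₂; N₂, r) ⇒ COLW(B₁ + B₂; N₁ + N₂, r). [folklore] -/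
theorem colw_add (B₁ B₂ : BondL2K ℂ 3 (periodsT3 F K) c₀ W₂ →ₗ[ℂ] BondL2K ℂ 3 (periodsT3 F K) c₀ W₂) {N₁ N₂ r : ℝ}
    (h₁ : ∀ (b : PBond (F.P K) 0) (Z : Matrix (Fin 2) (Fin 2) ℂ),
      ∑ bd : PBond (F.P K) 0, ‖(toL2 F K c₀).symm (B₁ (toL2 F K c₀ (Pi.single b Z))) bd‖
          * Real.exp (r * (Site.tdist (P := F.P K) (iterBlockOf (K - n) b.src) (iterBlockOf (K - n) bd.src) : ℝ)) ≤ N₁ * ‖Z‖)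
    (h₂ : ∀ (b : PBond (F.P K) 0) (Z : Matrix (Fin 2) (Fin 2) ℂ),
      ∑ bd : PBond (F.P K) 0, ‖(toL2 F K c₀).symm (B₂ (toL2 F K c₀ (Pi.single b Z))) bd‖
          * Real.exp (r * (Site.tdist (P := F.P K) (iterBlockOf (K - n) b.src) (iterBlockOf (K - n) bd.src) : ℝ)) ≤ N₂ * ‖Z‖)
    (b : PBond (F.P K) 0) (Z : Matrix (Fin 2) (Fin 2) ℂ) :
    ∑ bd : PBond (F.P K) 0, ‖(toL2 F K c₀).symm ((B₁ + B₂) (toL2 F K c₀ (Pi.single b Z))) bd‖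
        * Real.exp (r * (Site.tdist (P := F.P K) (iterBlockOf (K - n) b.src) (iterBlockOf (K - n) bd.src) : ℝ)) ≤ (N₁ + N₂) * ‖Z‖ := by
  simp_rw [LinearMap.add_apply, map_add, Pi.add_apply]
  calc ∑ bd : PBond (F.P K) 0, ‖(toL2 F K c₀).symm (B₁ (toL2 F K c₀ (Pi.single b Z))) bd + (toL2 F K c₀).symm (B₂ (toL2 F K c₀ (Pi.single b Z))) bd‖
          * Real.exp (r * (Site.tdist (P := F.P K) (iterBlockOf (K - n) b.src) (iterBlockOf (K - n) bd.src) : ℝ))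
      ≤ ∑ bd : PBond (F.P K) 0, (‖(toL2 F K c₀).symm (B₁ (toL2 F K c₀ (Pi.single b Z))) bd‖
          * Real.exp (r * (Site.tdist (P := F.P K) (iterBlockOf (K - n) b.src) (iterBlockOf (K - n) bd.src) : ℝ))
          + ‖(toL2 F K c₀).symm (B₂ (toL2 F K c₀ (Pi.single b Z))) bd‖
          * Real.exp (r * (Site.tdist (P := F.P K) (iterBlockOf (K - n) b.src) (iterBlockOf (K - n) bd.src) : ℝ))) := by
        refine Finset.sum_le_sum fun bd _ => ?_
        rw [← add_mul]
        exact mul_le_mul_of_nonneg_right (norm_add_le _ _) (Real.exp_pos _).le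
    _ ≤ (N₁ + N₂) * ‖Z‖ := by rw [Finset.sum_add_distrib, add_mul]; exact add_le_add (h₁ b Z) (h₂ b Z)

/-- COLW under scalars: COLW(B; N, r) ⇒ COLW(c • B; ‖c‖·N, r). [folklore] -/
theorem colw_smul (B : BondL2K ℂ 3 (periodsT3 F K) c₀ W₂ →ₗ[ℂ] BondL2K ℂ 3 (periodsT3 F K) c₀ W₂) (c : ℂ) {N r : ℝ}
    (hcol : ∀ (b : PBond (F.P K) 0) (Z : Matrix (Fin 2) (Fin 2) ℂ),
      ∑ bd : PBond (F.P K) 0, ‖(toL2 F K c₀).symm (B (toL2 F K c₀ (Pi.single b Z))) bd‖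
          * Real.exp (r * (Site.tdist (P := F.P K) (iterBlockOf (K - n) b.src) (iterBlockOf (K - n) bd.src) : ℝ)) ≤ N * ‖Z‖)
    (b : PBond (F.P K) 0) (Z : Matrix (Fin 2) (Fin 2) ℂ) :
    ∑ bd : PBond (F.P K) 0, ‖(toL2 F K c₀).symm ((c • B) (toL2 F K c₀ (Pi.single b Z))) bd‖
        * Real.exp (r * (Site.tdist (P := F.P K) (iterBlockOf (K - n) b.src) (iterBlockOf (K - n) bd.src) : ℝ)) ≤ (‖c‖ * N) * ‖Z‖ := by
  simp_rw [LinearMap.smul_apply, map_smul, Pi.smul_apply, norm_smul, mul_assoc, ← Finset.mul_sum]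
  exact mul_le_mul_of_nonneg_left (hcol b Z) (norm_nonneg c)

/-- COLW is monotone in its letters: `N ≤ N′`, `r′ ≤ r` ⇒ COLW(B; N, r) ⇒ COLW(B; N′, r′). [folklore] -/
theorem colw_mono (B : BondL2K ℂ 3 (periodsT3 F K) c₀ W₂ →ₗ[ℂ] BondL2K ℂ 3 (periodsT3 F K) c₀ W₂) {N N' r r' : ℝ} (hN : N ≤ N') (hr : r' ≤ r)
    (hcol : ∀ (b : PBond (F.P K) 0) (Z : Matrix (Fin 2) (Fin 2) ℂ),
      ∑ bd : PBond (F.P K) 0, ‖(toL2 F K c₀).symm (B (toL2 F K c₀ (Pi.single b Z))) bd‖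
          * Real.exp (r * (Site.tdist (P := F.P K) (iterBlockOf (K - n) b.src) (iterBlockOf (K - n) bd.src) : ℝ)) ≤ N * ‖Z‖)
    (b : PBond (F.P K) 0) (Z : Matrix (Fin 2) (Fin 2) ℂ) :
    ∑ bd : PBond (F.P K) 0, ‖(toL2 F K c₀).symm (B (toL2 F K c₀ (Pi.single b Z))) bd‖
        * Real.exp (r' * (Site.tdist (P := F.P K) (iterBlockOf (K - n) b.src) (iterBlockOf (K - n) bd.src) : ℝ)) ≤ N' * ‖Z‖ := by
  calc ∑ bd : PBond (F.P K) 0, ‖(toL2 F K c₀).symm (B (toL2 F K c₀ (Pi.single b Z))) bd‖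
          * Real.exp (r' * (Site.tdist (P := F.P K) (iterBlockOf (K - n) b.src) (iterBlockOf (K - n) bd.src) : ℝ))
      ≤ ∑ bd : PBond (F.P K) 0, ‖(toL2 F K c₀).symm (B (toL2 F K c₀ (Pi.single b Z))) bd‖
          * Real.exp (r * (Site.tdist (P := F.P K) (iterBlockOf (K - n) b.src) (iterBlockOf (K - n) bd.src) : ℝ)) :=
        Finset.sum_le_sum fun bd _ => mul_le_mul_of_nonneg_left
          (Real.exp_le_exp.2 (mul_le_mul_of_nonneg_right hr (Nat.cast_nonneg _))) (norm_nonneg _)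
    _ ≤ N * ‖Z‖ := hcol b Z
    _ ≤ N' * ‖Z‖ := mul_le_mul_of_nonneg_right hN (norm_nonneg _)

/-- COLW under finite sums: COLW(B i; N i, r) for `i ∈ s` ⇒ COLW(Σ_{i∈s} B i; Σ_{i∈s} N i, r). [folklore] -/
theorem colw_sum {ι : Type*} (s : Finset ι) (B : ι → BondL2K ℂ 3 (periodsT3 F K) c₀ W₂ →ₗ[ℂ] BondL2K ℂ 3 (periodsT3 F K) c₀ W₂) (N : ι → ℝ) {r : ℝ}
    (hcol : ∀ i ∈ s, ∀ (b : PBond (F.P K) 0) (Z : Matrix (Fin 2) (Fin 2) ℂ),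
      ∑ bd : PBond (F.P K) 0, ‖(toL2 F K c₀).symm (B i (toL2 F K c₀ (Pi.single b Z))) bd‖
          * Real.exp (r * (Site.tdist (P := F.P K) (iterBlockOf (K - n) b.src) (iterBlockOf (K - n) bd.src) : ℝ)) ≤ N i * ‖Z‖)
    (b : PBond (F.P K) 0) (Z : Matrix (Fin 2) (Fin 2) ℂ) :
    ∑ bd : PBond (F.P K) 0, ‖(toL2 F K c₀).symm ((∑ i ∈ s, B i) (toL2 F K c₀ (Pi.single b Z))) bd‖
        * Real.exp (r * (Site.tdist (P := F.P K) (iterBlockOf (K - n) b.src) (iterBlockOf (K - n) bd.src) : ℝ)) ≤ (∑ i ∈ s, N i) * ‖Z‖ := by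
  simp_rw [LinearMap.sum_apply, map_sum, Finset.sum_apply]
  calc ∑ bd : PBond (F.P K) 0, ‖∑ i ∈ s, (toL2 F K c₀).symm (B i (toL2 F K c₀ (Pi.single b Z))) bd‖
          * Real.exp (r * (Site.tdist (P := F.P K) (iterBlockOf (K - n) b.src) (iterBlockOf (K - n) bd.src) : ℝ))
      ≤ ∑ bd : PBond (F.P K) 0, ∑ i ∈ s, ‖(toL2 F K c₀).symm (B i (toL2 F K c₀ (Pi.single b Z))) bd‖
          * Real.exp (r * (Site.tdist (P := F.P K) (iterBlockOf (K - n) b.src) (iterBlockOf (K - n) bd.src) : ℝ)) := by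
        refine Finset.sum_le_sum fun bd _ => ?_
        rw [← Finset.sum_mul]
        exact mul_le_mul_of_nonneg_right (norm_sum_le _ _) (Real.exp_pos _).le
    _ = ∑ i ∈ s, ∑ bd : PBond (F.P K) 0, ‖(toL2 F K c₀).symm (B i (toL2 F K c₀ (Pi.single b Z))) bd‖
          * Real.exp (r * (Site.tdist (P := F.P K) (iterBlockOf (K - n) b.src) (iterBlockOf (K - n) bd.src) : ℝ)) := Finset.sum_comm
    _ ≤ ∑ i ∈ s, N i * ‖Z‖ := Finset.sum_le_sum fun i hi => hcol i hi b Z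
    _ = _ := by rw [Finset.sum_mul]

end Summit.QuantumFields.YangMills.Theorems.Prop7KernelRowColumnGauge

end
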